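import Summits.AtomisticToContinuum.Crystallization.Theorems.PalmUnimodularRigidityLayeredLawsSelectHcpCertificateDefs
import Summits.AtomisticToContinuum.Crystallization.Theorems.LayeredLawsSelectHcp.Negative.IntendedModel
import Literature.MathematicalPhysics.StatisticalMechanics.HcpHomogeneous

/-!
# Crux `LayeredLawsSelectHcp` (stmt-AtomisticToContinuum-9226), line `mtp-prestress-split-ergodic-frame`:
# re-rooting a labelled chart through the transported labels is again a rooted chart

Registered sub-goal `tube_reRoot_isRootedChart` of the crux item (lead c2, cycle 3; block R3-C of the certificate architecture).
The directed orbit-sum correctors read a local functional at the atom labelled `c` through the chart `reRoot X c`, i.e. through the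
index map `labelShift c` (translation `u ↦ c + u` on even layers, inversion `u ↦ c − u` on odd layers).  On the ideal hcp this index
map is an isometry onto the structure re-rooted at `c` (`hcpSite (labelShift c u) = hcpSite c + hcpSite u`, resp. `hcpSite c − hcpSite u`
— `hcp_add_of_even`, `barlowPos_alternating_sub_b`), so `reRoot X c` is a rooted chart of the re-rooted carrier `S − X c`: root at
`0`, onto, and ideal unit struts ↔ bonds. [folklore]
-/

noncomputable section

namespace Summit.AtomisticToContinuum.Crystallization.Theorems.PalmUnimodularRigidity.LayeredLawsSelectHcp

open MeasureTheory Set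
open Literature.MathematicalPhysics.StatisticalMechanics Literature.Geometry.DiscreteGeometry
open Summit.AtomisticToContinuum.Crystallization.Theorems.LayeredLawsSelectHcp.Negative.IntendedModel
  (barlowPos_alternating_sub_b)

/-- `hcpSite` on indices of an EVEN layer is additive: `hcpSite a h (c + u) = hcpSite a h c + hcpSite a h u`. [folklore] -/
theorem hcpSite_add_of_even (a h : ℝ) {c : ℤ × ℤ × ℤ} (hc : Even c.1) (u : ℤ × ℤ × ℤ) :
    hcpSite a h (c + u) = hcpSite a h c + hcpSite a h u := by
  obtain ⟨k, i, j⟩ := c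
  obtain ⟨k', i', j'⟩ := u
  show barlowPos a h alternatingHagg (k + k') (i + i') (j + j') =
    barlowPos a h alternatingHagg k i j + barlowPos a h alternatingHagg k' i' j'
  exact (hcp_add_of_even a h hc i j k' i' j').symm

/-- `hcpSite` on indices of an ODD layer is inverting: `hcpSite a h (c − u) = hcpSite a h c − hcpSite a h u` (the re-rooting of hcp at a
`B`-site is the point inversion). [folklore] -/
theorem hcpSite_sub_of_odd (a h : ℝ) {c : ℤ × ℤ × ℤ} (hc : Odd c.1) (u : ℤ × ℤ × ℤ) :
    hcpSite a h (c - u) = hcpSite a h c - hcpSite a h u := by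
  obtain ⟨k, i, j⟩ := c
  obtain ⟨k', i', j'⟩ := u
  have hk1 : Even (k - 1) := by
    rcases hc with ⟨m, hm⟩
    exact ⟨m, by omega⟩
  -- `hcpSite c = hcpSite (k-1, i, j) + b` with `b = barlowPos 1 0 0`
  have hc' : barlowPos a h alternatingHagg k i j =
      barlowPos a h alternatingHagg (k - 1) i j + barlowPos a h alternatingHagg 1 0 0 := by
    have := hcp_add_of_even a h hk1 i j 1 0 0
    rw [this]; congr 1 <;> simp
  -- `b - hcpSite u = hcpSite (1 - k', -i', -j')`
  have hb : barlowPos a h alternatingHagg 1 0 0 - barlowPos a h alternatingHagg k' i' j' =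
      barlowPos a h alternatingHagg (1 - k') (-i') (-j') := by
    have := barlowPos_alternating_sub_b a h k' i' j'
    rw [← neg_sub, this, neg_neg]
  show barlowPos a h alternatingHagg (k - k') (i - i') (j - j') =
    barlowPos a h alternatingHagg k i j - barlowPos a h alternatingHagg k' i' j'
  rw [hc', add_sub_assoc, hb, hcp_add_of_even a h hk1]
  congr 1; omega

/-- The ideal sites read through `labelShift c` are the ideal sites translated/inverted at `hcpSite c`; in particular `labelShift c`
preserves all ideal distances. [folklore] -/
theorem dist_hcpSite_labelShift (a h : ℝ) (c u w : ℤ × ℤ × ℤ) :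
    dist (hcpSite a h (labelShift c u)) (hcpSite a h (labelShift c w)) = dist (hcpSite a h u) (hcpSite a h w) := by
  unfold labelShift
  split_ifs with hc
  · rw [hcpSite_add_of_even a h hc, hcpSite_add_of_even a h hc, dist_add_left]
  · have hodd : Odd c.1 := Int.not_even_iff_odd.1 hc
    rw [hcpSite_sub_of_odd a h hodd, hcpSite_sub_of_odd a h hodd, dist_sub_left]

/-- `labelShift c` is an involution up to sign: it is a bijection of the index set (explicit inverse). [folklore] -/
theorem labelShift_surjective (c w : ℤ × ℤ × ℤ) : ∃ u, labelShift c u = w := by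
  unfold labelShift
  split_ifs
  · exact ⟨w - c, by abel⟩
  · exact ⟨c - w, by abel⟩

/-- **Registered sub-goal `tube_reRoot_isRootedChart` (R3-C).**  Re-rooting a rooted labelled chart of `S` at the label `c` through the
transported labels gives a rooted labelled chart of the re-rooted set `S − X c`. [folklore] -/
theorem tube_reRoot_isRootedChart :
    ∀ S : Set (EuclideanSpace ℝ (Fin 3)), ∀ X : ℤ × ℤ × ℤ → EuclideanSpace ℝ (Fin 3), IsRootedChart S X →
      ∀ c : ℤ × ℤ × ℤ, IsRootedChart ((fun z : EuclideanSpace ℝ (Fin 3) => z - X c) '' S) (reRoot X c) := by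
  intro S X hX c
  obtain ⟨hX0, hXS, hSX, hbond⟩ := hX
  refine ⟨?_, ?_, ?_, ?_⟩
  · simp [reRoot, labelShift_zero]
  · intro u
    exact ⟨X (labelShift c u), hXS _, rfl⟩
  · rintro y ⟨y', hy', rfl⟩
    obtain ⟨w, rfl⟩ := hSX y' hy'
    obtain ⟨u, hu⟩ := labelShift_surjective c w
    exact ⟨u, by simp [reRoot, hu]⟩
  · intro u w
    have hd : dist (reRoot X c u) (reRoot X c w) = dist (X (labelShift c u)) (X (labelShift c w)) := by
      simp only [reRoot]
      rw [dist_sub_right]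
    rw [hd, ← hbond, dist_hcpSite_labelShift]

end Summit.AtomisticToContinuum.Crystallization.Theorems.PalmUnimodularRigidity.LayeredLawsSelectHcp

end
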